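import Summits.CriticalPhenomena.PercolationContinuityZ3.Theorems.PercNearOneGluingNoHeavyLowerTailIncStarIrreducibleIndep
import HarnessLib

/-!
# Portrait of a minimal counterexample to the increasing star (kernel, standard axioms)

Support file for the Sahi programme (`--supports stmt-CriticalPhenomena-4575`, prover prim-sahi-p2 gen 13).  No definitions, no named
facts, no sorries; standard axioms.  Memo `…/prim-sahi-p2/PROOF-E3.md` §24, `FROM-prim-sahi-p2-gen13-INDEPENDENT-MARKS.md`.

`IncStarIrreducible.incStar_of_irreducible_indep_six` lets a proof of the increasing star assume an irreducible marked weighted graph on `≥ 6`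
vertices whose four marks are pairwise non-adjacent.  Two more features then come for free from the 2-connectedness clause, and this file adds
them to the hypothesis: **the root and each of the three targets have at least two neighbours of positive weight** (necessarily unmarked).
Indeed a mark with at most one positive neighbour `u` is cut off by `u` (decompositions `{s,u} ∪ (V ∖ {s})` for the root, `(V ∖ {t}) ∪ {t,u}`
for a target).  Theorem `incStar_of_irreducible_portrait`: the increasing star holds on every finite weighted graph as soon as it holds for
every weight on `Fin n`, `n ≥ 6`, and marks `s,a,b,c` that are pairwise distinct and pairwise non-adjacent, `w` loop-free, 2-connected, every
unmarked vertex with a positive neighbour outside any two given vertices, no blob, no targetless root side, and every mark with two distinct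
positive neighbours.  (By the K₇ fibre certificate of memo §22h one may informally add `n ≥ 8`; that is not a kernel statement.)
-/

noncomputable section

namespace Summit.CriticalPhenomena.PercolationContinuityZ3.Theorems

namespace IncStarIrreducible

open Finset MeasureTheory Literature.Probability.Percolation Literature.Probability.LatticeModels
open scoped Classical

variable {n : ℕ}

/-- From the 2-connectedness clause: the root has two distinct neighbours of positive weight (given two further vertices `a ≠ b`, both `≠ s`,
and root–target pairs of weight zero are not even needed). [this work] -/
theorem root_two_neighbours (w : Sym2 (Fin n) → unitInterval) {s a b : Fin n} (hsa : s ≠ a) (hsb : s ≠ b) (hab : a ≠ b)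
    (hloop : ∀ x : Fin n, w s(x, x) = 0)
    (h2c : ∀ (V₁ V₂ : Finset (Fin n)) (x : Fin n), (∀ y, y ∈ V₁ → y ∈ V₂ → y = x) → x ∈ V₁ → x ∈ V₂ → s ∈ V₁ →
          (∀ y, y ∈ V₁ ∨ y ∈ V₂) → (∀ y z, y ∈ V₁ → z ∈ V₂ → y ≠ x → z ≠ x → w s(y, z) = 0) →
          (∀ y ∈ V₁, y = x) ∨ (∀ z ∈ V₂, z = x)) :
    ∃ u u' : Fin n, u ≠ u' ∧ w s(s, u) ≠ 0 ∧ w s(s, u') ≠ 0 := by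
  by_contra hno
  push Not at hno
  -- all positive neighbours of `s` coincide with one vertex `u ≠ s`
  obtain ⟨u, hus, hu⟩ : ∃ u : Fin n, u ≠ s ∧ ∀ z, w s(s, z) ≠ 0 → z = u := by
    by_cases hex : ∃ u₀, w s(s, u₀) ≠ 0
    · obtain ⟨u₀, hu₀⟩ := hex
      refine ⟨u₀, fun h => hu₀ (by rw [h]; exact hloop s), fun z hz => ?_⟩
      by_contra hzu
      exact hu₀ (hno z u₀ hzu hz)
    · push Not at hex
      exact ⟨a, hsa.symm, fun z hz => absurd (hex z) hz⟩
  have key := h2c {s, u} (Finset.univ.erase s) u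
    (fun y hy hy' => by
      simp only [Finset.mem_insert, Finset.mem_singleton] at hy
      rcases hy with rfl | rfl
      · exact absurd (Finset.mem_erase.1 hy').1 (fun h => h rfl)
      · rfl)
    (by simp) (Finset.mem_erase.2 ⟨hus, Finset.mem_univ u⟩) (by simp)
    (fun y => by
      by_cases hys : y = s
      · exact Or.inl (by simp [hys])
      · exact Or.inr (Finset.mem_erase.2 ⟨hys, Finset.mem_univ y⟩))
    (fun y z hy _ hyu hzu => by
      simp only [Finset.mem_insert, Finset.mem_singleton] at hy
      rcases hy with rfl | rfl
      · by_contra hz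
        exact hzu (hu z hz)
      · exact absurd rfl hyu)
  rcases key with h | h
  · exact hus.symm (h s (by simp))
  · have ha := h a (Finset.mem_erase.2 ⟨hsa.symm, Finset.mem_univ a⟩)
    have hb := h b (Finset.mem_erase.2 ⟨hsb.symm, Finset.mem_univ b⟩)
    exact hab (ha.trans hb.symm)

/-- From the 2-connectedness clause: a target `t` has two distinct neighbours of positive weight (given marks `s ≠ t` and a third mark
`b ∉ {s,t}`). [this work] -/
theorem target_two_neighbours (w : Sym2 (Fin n) → unitInterval) {s t b : Fin n} (hst : s ≠ t) (hsb : s ≠ b) (htb : t ≠ b)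
    (hloop : ∀ x : Fin n, w s(x, x) = 0)
    (h2c : ∀ (V₁ V₂ : Finset (Fin n)) (x : Fin n), (∀ y, y ∈ V₁ → y ∈ V₂ → y = x) → x ∈ V₁ → x ∈ V₂ → s ∈ V₁ →
          (∀ y, y ∈ V₁ ∨ y ∈ V₂) → (∀ y z, y ∈ V₁ → z ∈ V₂ → y ≠ x → z ≠ x → w s(y, z) = 0) →
          (∀ y ∈ V₁, y = x) ∨ (∀ z ∈ V₂, z = x)) :
    ∃ u u' : Fin n, u ≠ u' ∧ w s(t, u) ≠ 0 ∧ w s(t, u') ≠ 0 := by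
  by_contra hno
  push Not at hno
  obtain ⟨u, hut, hu⟩ : ∃ u : Fin n, u ≠ t ∧ ∀ z, w s(t, z) ≠ 0 → z = u := by
    by_cases hex : ∃ u₀, w s(t, u₀) ≠ 0
    · obtain ⟨u₀, hu₀⟩ := hex
      refine ⟨u₀, fun h => hu₀ (by rw [h]; exact hloop t), fun z hz => ?_⟩
      by_contra hzu
      exact hu₀ (hno z u₀ hzu hz)
    · push Not at hex
      exact ⟨s, hst, fun z hz => absurd (hex z) hz⟩
  have key := h2c (Finset.univ.erase t) {t, u} u
    (fun y hy hy' => by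
      simp only [Finset.mem_insert, Finset.mem_singleton] at hy'
      rcases hy' with rfl | rfl
      · exact absurd (Finset.mem_erase.1 hy).1 (fun h => h rfl)
      · rfl)
    (Finset.mem_erase.2 ⟨hut, Finset.mem_univ u⟩) (by simp) (Finset.mem_erase.2 ⟨hst, Finset.mem_univ s⟩)
    (fun y => by
      by_cases hyt : y = t
      · exact Or.inr (by simp [hyt])
      · exact Or.inl (Finset.mem_erase.2 ⟨hyt, Finset.mem_univ y⟩))
    (fun y z _ hz hyu hzu => by
      simp only [Finset.mem_insert, Finset.mem_singleton] at hz
      rcases hz with hz | hz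
      · rw [hz]
        by_contra hw
        rw [Sym2.eq_swap] at hw
        exact hyu (hu y hw)
      · exact absurd hz hzu)
  rcases key with h | h
  · have hs := h s (Finset.mem_erase.2 ⟨hst, Finset.mem_univ s⟩)
    have hb := h b (Finset.mem_erase.2 ⟨htb.symm, Finset.mem_univ b⟩)
    exact hsb (hs.trans hb.symm)
  · exact hut.symm (h t (by simp))

/-- **Portrait of a minimal counterexample.**  The increasing star holds on every finite weighted graph as soon as it holds for every weight on
`Fin n` with `6 ≤ n` and marks `s, a, b, c` such that: the marks are pairwise distinct and pairwise of weight zero (independent), `w` is loop-free,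
the marked graph is 2-connected, every unmarked vertex has a positive neighbour outside any two given vertices, there is no blob and no
targetless root side (gen 12's clauses), AND the root and each target have two distinct neighbours of positive weight. [this work] -/
theorem incStar_of_irreducible_portrait
    (H : ∀ (n : ℕ) (w : Sym2 (Fin n) → unitInterval) (s a b c : Fin n), 6 ≤ n →
      s ≠ a → s ≠ b → s ≠ c → a ≠ b → a ≠ c → b ≠ c →
      (∀ x : Fin n, w s(x, x) = 0) →
      (∀ (V₁ V₂ : Finset (Fin n)) (x : Fin n), (∀ y, y ∈ V₁ → y ∈ V₂ → y = x) → x ∈ V₁ → x ∈ V₂ → s ∈ V₁ →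
          (∀ y, y ∈ V₁ ∨ y ∈ V₂) → (∀ y z, y ∈ V₁ → z ∈ V₂ → y ≠ x → z ≠ x → w s(y, z) = 0) →
          (∀ y ∈ V₁, y = x) ∨ (∀ z ∈ V₂, z = x)) →
      (∀ x y y' : Fin n, x ≠ s → x ≠ a → x ≠ b → x ≠ c → x ≠ y → x ≠ y' → y ≠ y' →
          ∃ z, z ≠ y ∧ z ≠ y' ∧ w s(x, z) ≠ 0) →
      (∀ (B : Finset (Fin n)) (u v : Fin n), B.Nonempty → u ∉ B → v ∉ B → u ≠ v → s ∉ B → a ∉ B → b ∉ B → c ∉ B →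
          ∃ x ∈ B, ∃ z, z ∉ B ∧ z ≠ u ∧ z ≠ v ∧ w s(x, z) ≠ 0) →
      (∀ (R : Finset (Fin n)) (h u v : Fin n), s ∈ R → h ∈ R → h ≠ s → u ∉ R → v ∉ R → u ≠ v → a ∉ R → b ∉ R →
          c ∉ R → ∃ x ∈ R, ∃ z, z ∉ R ∧ z ≠ u ∧ z ≠ v ∧ w s(x, z) ≠ 0) →
      w s(s, a) = 0 → w s(s, b) = 0 → w s(s, c) = 0 → w s(a, b) = 0 → w s(a, c) = 0 → w s(b, c) = 0 →
      (∃ u u' : Fin n, u ≠ u' ∧ w s(s, u) ≠ 0 ∧ w s(s, u') ≠ 0) →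
      (∃ u u' : Fin n, u ≠ u' ∧ w s(a, u) ≠ 0 ∧ w s(a, u') ≠ 0) →
      (∃ u u' : Fin n, u ≠ u' ∧ w s(b, u) ≠ 0 ∧ w s(b, u') ≠ 0) →
      (∃ u u' : Fin n, u ≠ u' ∧ w s(c, u) ≠ 0 ∧ w s(c, u') ≠ 0) →
      0 ≤ sahiE3 (prodBernoulli w) (openConn s a) (openConn s b) (openConn s c))
    {V : Type*} [Fintype V] (w : Sym2 V → unitInterval) (s a b c : V) :
    0 ≤ sahiE3 (prodBernoulli w) (openConn s a) (openConn s b) (openConn s c) := by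
  refine incStar_of_irreducible_indep_six (fun n w s a b c hn hsa hsb hsc hab hac hbc hloop h2c hdeg hblob hroot
    zSA zSB zSC zAB zAC zBC => ?_) w s a b c
  exact H n w s a b c hn hsa hsb hsc hab hac hbc hloop h2c hdeg hblob hroot zSA zSB zSC zAB zAC zBC
    (root_two_neighbours w hsa hsb hab hloop h2c)
    (target_two_neighbours w hsa hsb hab hloop h2c)
    (target_two_neighbours w hsb hsa (Ne.symm hab) hloop h2c)
    (target_two_neighbours w hsc hsa (Ne.symm hac) hloop h2c)

end IncStarIrreducible

end Summit.CriticalPhenomena.PercolationContinuityZ3.Theorems
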